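import Summits.BirchSwinnertonDyer.Rank1Residual.O5.HeegnerLogTransportThreeLogUnitCertCore
import HarnessLib
import HarnessLib.Audit.Tags

/-!
# O5 KL3 part 24, CERT file (§5–§6): the division-free LOG-UNIT front-end `logUnitOKQ` + ladder and the ENDs
# `…_cited_s0f_ratlog` / `…_cited_s0f_iso_ratlog` with `hQW` DISCHARGED per row (cell `b2b-bsdres`, lane CLASS-CLOSURE,
# class O5 (t′); seat o5-r2 GEN 26; §§0–4 = the sibling CORE file `O5/HeegnerLogTransportThreeLogUnitCertCore.lean`)

HONEST FRAMING (cell `b2b-bsdres`, run/shared/lean/b2b/bsd-rank1-residual/, verbatim in every file): the goal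
of the cell is to DELETE the COMBINATION-SHAPED residual classes of the Birch–Swinnerton-Dyer formula for ALL
analytic-rank `≤ 1` elliptic curves over `ℚ` — "full BSD formula for every rank `≤ 1` curve in class `C`"
assembled STRICTLY from published theorems — so that the rank-`≤ 1` remainder becomes exactly the
CONSTRUCTION-SHAPED classes, which are TYPED (missing-input `Prop`s), NOT attempted. This is not "finishing
BSD". Lane CLASS-CLOSURE: research routes; no claim beyond the stated classes; nothing is booked here; no mark
of `RESIDUAL-MAP.md` moves; census numbers are EVIDENCE, never a Literature fact. THEOREMS plus ONE `Bool`
checker `def` (`logUnitOKQ`, the shape of the tree's `Supersingular.dblOKQ` / `addOKQ`); no named fact, no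
conjecture node (net named-fact debt `0`); no node file is touched; O5 stays OPEN.

## Contents (the source's §5 / §6 bullets, worked-rows paragraph, framing, references and placement note, VERBATIM; §§0–4 are the CORE file)

* §5 `logUnitOKQ` + `logUnitOKQ_sound` + **`exists_logUnit_point_of_ladder`** — division-free front-end: a base
  point `(x₀, y₀) ∈ W(ℚ)`, a tree LADDER (`Supersingular.ladderRunQ`, `decide +kernel`) to
  `R = m • (x₀, y₀)`, `m = qScalar 1 steps`, and the check `0 < k ∧ p^k ∥ m ∧ p ∤ num, den (x_R · p^{2k})`
  (`decide +kernel`) give `hQW`. For the KL3 (t′) rows: `p = 3`, `m = m₀ = [W(ℚ₃) : W₁(ℚ₃)] = 3·c₃ = 6`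
  (type III*, `c₃ = 2`), `k = 1` — two ladder steps.
* §6 ENDs **`o5_index_unit_of_ordinary_companion_cited_s0f_ratlog`** / **`…_cited_s0f_iso_ratlog`** — the ENDs
  of record with `hQW` REPLACED by `(h₀, steps, hrun, hcert)`; every other binder verbatim, same displayed facts.

Worked rows (EVIDENCE that the front-end closes, `HOME/b2b-bsdres-o5-r2/gen26/census/ladder_logcert.py`, exact
rationals): `133020o1` (`⟨0,0,0,−972,8289⟩`, `Q₀ = (−12, 135)`): `6 • Q₀ = (53506441/788544, −353427662555/700227072)`,
`788544 = 2⁶·3²·37²`, level `1 = ord₃ 6` ✓; `25938i1` (`⟨1,−1,1,−10181,302077⟩`, `Q₀ = (−5, 596)`):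
`6 • Q₀ = (103192633/968256, 565547791711/952763904)`, `968256 = 2⁶·3²·41²` ✓ — the two rows whose `hcong`
is already kernel-certified (part 20b, p356989); both census `dE = 0`. Row instances are NOT in this file:
part 24b (`O5/HeegnerLogTransportThreeLogUnitCertRows.lean`, THEOREMS over part 20b's curve literals) decides
both rows' `hQW` (and their global minimality) in the kernel. BATCH TIE (EVIDENCE, `gen26/census/kl3_logcert_batch.py`
→ `KL3-logcert-batch-o5r2-g26.tsv`): on ALL 870 KL3 pairs (363 distinct `W`, every one III* at 3, `m₀ = 6`)
the certificate's prediction `k − ord₃ m` (first `m ∈ {3, 6}` with `x(m•Q₀) ∉ ℤ₃`) EQUALS the census `dE`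
(870/870), and `logUnitOKQ` holds on exactly the 753 `dE = 0` pairs (310 distinct `W`).

HONEST FRAMING, again: the END conclusion and every displayed published fact (Kriz–Li 1.16, Poitou–Tate, local
Euler–Poincaré, Yan–Zhu 4.15, Wuthrich Lemma 20, modularity, GZK, Kolyvagin) are unchanged; `hQW` moves from
the INSTRUMENT column `dE` to a kernel-checked certificate, nothing else. O5 OPEN; nothing booked.

References: [SilvermanAEC2009] III.2.3 (group law), IV.6.3(a), IV.6.4, VII.2.2 (`3v(x) = 2v(y)` on `E₁`),
VII.3.1; [Castella2018] §2.2, Thm. 2.3 (arXiv:1704.06608 p. 5: `log_{ω_E}`); [KrizLi2019] Thm. 1.16, Rem. 1.17;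
[KrausOesterle1992] Prop. 3; cell files `Additive/PadicLogFormalGroup.lean`, `Additive/PadicLogImage.lean`,
`X11b/BDPRouteLocalIndex.lean` (§1 pattern), `Supersingular/RationalLadder.lean` (ladder),
`O5/HeegnerLogTransportThreeRatLogUnit.lean` (part 12), `O5/HeegnerLogTransportThreeStepZeroEndAnyDiscr{,Iso}.lean` (ENDs).

## TYPER PLACEMENT NOTE

Imports TREE files only. Namespace `Summit.BirchSwinnertonDyer.Rank1Residual.O5.HeegnerLogTransport`; one `def`
(`logUnitOKQ : ℕ → ℕ → ℕ → ℚ → Bool`, a checker, no mathematical object) ⇒ propose as kind definition (async-audit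
lane, as part 20b) or split §5–§6 off if the gate prefers; `lean check` rc 0, 0 sorries, 0 warnings; axioms
`propext`, `Classical.choice`, `Quot.sound` (o5-r2 GEN 26). Target path `O5/HeegnerLogTransportThreeLogUnitCert.lean`.

### cc-typer-5 GEN 20 (O5 §3.5 / O6 §3.4 typer of record) — by-name ask A-O5-G26-1 of o5-r2 GEN 26, HOME/INBOX.md l.14784: '(c) PART 24 c9ccd78a3c12acdd → NEW leaf
`O5/HeegnerLogTransportThreeLogUnitCert.lean` … THEN (d) PART 24b 45004bfa402f8b0d → NEW leaf `O5/HeegnerLogTransportThreeLogUnitCertRows.lean` (by sha, byte-identical + your ¶,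
or not at all)'; memo `HOME/b2b-bsdres-o5-r2/gen26/O5-GEN26.md` ec0f62f29e09e06b; order of record (after this seat's parts 20 / 20b / 21 / (a) / 23): core → cert → rows.

Source: `HOME/b2b-bsdres-o5-r2/gen26/lean/HeegnerLogTransportThreeLogUnitCert.lean` sha16 `c9ccd78a3c12acdd` (516 l.; `gen26/SHA16.txt`; o5-r2's checks: farm rc 0 / 0 warn /
0 sorry, `#print axioms` of both ENDs + `logUnitOKQ_sound` standard, dedup of 18 names none; joint scratch with part 24b `gen26/lean/scratch/concat_cert_rows.lean`
e90cc623846ed20a rc 0), re-hashed by the typer right before writing.  ONE TYPER DEDUP EDIT (gate-forced; the byte-identical CORE dry-ran BOUNCED `dedup.landed`): §0's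
second helper `padicNorm_le_inv_of_norm_lt_one` (`‖t‖ < 1 ⇒ ‖t‖ ≤ p⁻¹` in `ℚ_p`) restated the already-landed, importable `Literature.NumberTheory.EllipticCurves.norm_le_inv_of_norm_lt_one`
(`Literature/NumberTheory/EllipticCurves/PAdicHeightsLogProofs.lean` l.88, in the import closure) ⇒ its 4 lines (source l.124–127) became a 4-line comment (line-neutral) and its ONE
call site (l.230, proof of `norm_padicLog_eq_norm_formalParameter`) uses the landed lemma; nothing else differs (corrected source sha16 b133124a52db197f, `class-closure/typer-5/gen20/dedupfix.diff`;
17 of the 18 declarations and every statement byte-identical; flagged to o5-r2 on the bus).  SPLIT (typer; the source's 516 lines exceed the gate's 400-line `lint.size` for NEW files under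
`Rank1Residual/O5/` — cf. KL3 part 18, cc-typer-5 GEN 19 — and the source's own placement note above allows 'split §5–§6 off'): PART 24 = TWO files, every declaration
block byte-identical and in source order, ONE namespace `…O5.HeegnerLogTransport` (every FQN is the source's); script `class-closure/typer-5/gen20/g26_place.py`, anchors asserted:
  CORE = `O5/HeegnerLogTransportThreeLogUnitCertCore.lean` = source l.1–81 (imports + module text UNCHANGED — so its §5 / §6 bullets describe the sibling CERT file) + this ¶ +
         l.82–335 (§0 helpers, §1 `‖log_W t‖ = ‖t‖` on `pℤ_p` for odd `p`, §2 `padicLog = log_W ∘ z` on `E₁`, §3 KERNEL `dE` READOUT `valuation_padicLog_of_nsmul_eq`,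
         §4 `exists_logUnit_point_of_nsmul_eq`) + the closing `end`s (l.513–516); THEOREMS ONLY (12 incl. one `private`, after the dedup edit), kind proof;
  CERT = `O5/HeegnerLogTransportThreeLogUnitCert.lean` (the ASKED module name, so part 24b's `import …LogUnitCert` resolves byte-identically) = `import …LogUnitCertCore` + a header
         assembled from source l.14–22 / l.47–53 / l.55–64 / l.66–74 / l.76–81 VERBATIM + this ¶ + source l.84–104 (options, `open`s, namespace) + l.337–516 VERBATIM (§5 the ONE
         `Bool` checker `def logUnitOKQ` + `logUnitOKQ_sound` + `exists_logUnit_point_of_ladder`, §6 ENDs `o5_index_unit_of_ordinary_companion_cited_s0f_ratlog` /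
         `…_cited_s0f_iso_ratlog`, closing `end`s); kind definition ⇒ the gate's review / async-audit lane (as part 20b p356989).
  THIS file = CERT (CORE = p359674, this seat, in the tree).
Checks by the typer before each proposal: DEDUP `lean search --decl` on all 17 + 6 new names (none; the gate's statement-level `dedup.landed` caught the 18th, see above); standalone farm `lean check` on TREE imports (rc 0 / 0 warnings / 0 sorries;
CERT after CORE's olean, ROWS after CERT's — concat scratches meanwhile), `#print axioms` of `exists_logUnit_point_of_nsmul_eq` / `…_cited_s0f_iso_ratlog` /
`KL3X3EInstances.exists_logUnit_point_W25938i1'` standard, dry-run clean; imports in the tree: E117 `…StepZeroEndAnyDiscrIso` p357191 (harvest-2), part 12 `…RatLogUnit` p351404,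
`Additive.PadicLogFormalGroup`, `Supersingular.RationalLadder`, part 20b `…IsoCurrencyRows` p356989, `X11b.KrausMinimalityGeneralTwo`.
CONTENT LABELS (source, unchanged): theorems + ONE `Bool` checker `def` (CERT file), 0 `@[conjecture]`, 0 Literature facts (net named-fact debt 0), no `sorry`; published inputs
stay displayed hypotheses BY NAME (A314 Kriz–Li 1.16, Poitou–Tate, local EP, Yan–Zhu 4.15, Wuthrich L20, modularity, GZK — exactly `_cited_s0f`'s); `hQW` moves from the
INSTRUMENT column `dE` (PARI `elllog`) to a kernel-checked certificate, nothing else; the batch tie 870 / 870 and the worked rows are EVIDENCE. HONEST FRAMING (cell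
`b2b-bsdres`): research route, lane CLASS-CLOSURE §3.5 O5; CONDITIONAL ENDs — nothing asserted beyond the displayed binders, nothing booked, no mark / label / count / tier
of `RESIDUAL-MAP.md` moves; census = EVIDENCE, never a Literature fact; O5 OPEN.
-/

set_option autoImplicit false

noncomputable section

open scoped Classical

open WeierstrassCurve Literature.NumberTheory.EllipticCurves
  Literature.NumberTheory.EllipticCurves.ModularForms
  Literature.NumberTheory.EllipticCurves.Rank1Residual
  Literature.NumberTheory.EllipticCurves.Rank1Residual.Typed
open Summit.BirchSwinnertonDyer.Rank1Residual.X1.CongruenceTransfer (TorsionIso)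
open Summit.BirchSwinnertonDyer.Rank1Residual.X11b (embAt padicPointOf)
open Summit.BirchSwinnertonDyer.Rank1Residual.Additive.LocalLog
  (padicLog padicLog_eq_zero_iff padicLog_eq_padicLogPoint_nsmul_div padicLogPoint_nsmul
    index_formalFiltration_two_ne_zero)
open IsDedekindDomain (HeightOneSpectrum)
open Literature.NumberTheory.GaloisCohomology (poitouTate_selmerStructure_duality)
open Literature.NumberTheory.GaloisRepresentations (localEulerPoincareCharacteristic)
open scoped NumberField

namespace Summit.BirchSwinnertonDyer.Rank1Residual.O5.HeegnerLogTransport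

/-! ## §5 Division-free front-end: ladder + `logUnitOKQ`, both `decide +kernel` -/

section Checker

/-- **Division-free LOG-UNIT check** on a prime `p`, a level `k`, a multiplier `m` and the abscissa `x_R` of
`R = m • Q₀`: `0 < k`, `p ^ k ∣ m`, `p ^ (k+1) ∤ m` (so `ord_p m = k`) and `p ∤ num (x_R · p^{2k})`,
`p ∤ den (x_R · p^{2k})` (so `ord_p x_R = −2k`). Decided by `decide +kernel` on numerals — the shape of the
tree's `Supersingular.dblOKQ` / `addOKQ`. [cite: SilvermanAEC2009, VII.2.2] -/
def logUnitOKQ (p k m : ℕ) (xR : ℚ) : Bool :=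
  decide (0 < k) && decide (p ^ k ∣ m) && !decide (p ^ (k + 1) ∣ m) &&
    !decide ((p : ℤ) ∣ (xR * (p : ℚ) ^ (2 * k)).num) && !decide (p ∣ (xR * (p : ℚ) ^ (2 * k)).den)

variable {p : ℕ} [hp : Fact p.Prime]

/-- **Soundness of the log-unit check**: `logUnitOKQ p k m x_R ⟹ 0 < k ∧ padicValNat p m = k ∧ padicValRat p x_R = −2k`.
[cite: SilvermanAEC2009, VII.2.2] -/
theorem logUnitOKQ_sound {k m : ℕ} {xR : ℚ} (h : logUnitOKQ p k m xR = true) :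
    0 < k ∧ padicValNat p m = k ∧ padicValRat p xR = -(2 * (k : ℤ)) := by
  simp only [logUnitOKQ, Bool.and_eq_true, Bool.not_eq_true', decide_eq_true_eq,
    decide_eq_false_iff_not] at h
  obtain ⟨⟨⟨⟨hk, hdvd⟩, hndvd⟩, hnum⟩, hden⟩ := h
  have hm0 : m ≠ 0 := by rintro rfl; exact hndvd (dvd_zero _)
  refine ⟨hk, ?_, ?_⟩
  · have h1 := (padicValNat_dvd_iff_le hm0).mp hdvd
    have h2 : ¬ k + 1 ≤ padicValNat p m := fun h' => hndvd ((padicValNat_dvd_iff_le hm0).mpr h')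
    omega
  · have hp0 : (p : ℚ) ≠ 0 := Nat.cast_ne_zero.mpr hp.out.ne_zero
    have hx0 : xR ≠ 0 := by
      intro h0; apply hnum; rw [h0, zero_mul, Rat.num_zero]; exact dvd_zero _
    have hvu : padicValRat p (xR * (p : ℚ) ^ (2 * k)) = 0 := by
      rw [padicValRat_def, padicValInt.eq_zero_of_not_dvd hnum, padicValNat.eq_zero_of_not_dvd hden]
      simp
    rw [padicValRat.mul hx0 (pow_ne_zero _ hp0), padicValRat.pow, padicValRat.self hp.out.one_lt] at hvu
    push_cast at hvu
    linarith

end Checker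

section Ladder

open Summit.BirchSwinnertonDyer.Rank1Residual.Supersingular (QStep ladderRunQ qScalar nsmul_some_eq_of_ladderRunQ)

variable (W : WeierstrassCurve ℚ) [W.IsElliptic] [W.IsGloballyMinimal] (p : ℕ) [Fact p.Prime]
  {K : Type} [Field K] [NumberField K]

/-- **`hQW` BY CERTIFICATE.** Base point `(x₀, y₀) ∈ W(ℚ)` (`W` globally minimal), `p` odd, a tree LADDER
(`Supersingular.ladderRunQ`, decided by `decide +kernel`) from `(x₀, y₀)` to `R = m • (x₀, y₀) = (x_f, y_f)`,
`m = qScalar 1 steps`, and the log-unit check `logUnitOKQ p k m x_f` (`decide +kernel`): then in EVERY `W(K)` along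
EVERY `ι : K →+* ℚ_p` there is a point of infinite order with `padicLogOrd W p ι Q = 0` — the END binder `hQW`
(`p = 3`, `ι = embAt K 3 𝔭 h𝔭 he hf`; for the KL3 (t′) rows `m = m₀ = 6`, `k = 1`, two steps).
[cite: SilvermanAEC2009, III.2.3, IV.6.4 and VII.2.2] [cite: Castella2018, §2.2 and Thm. 2.3 (arXiv:1704.06608 p. 5)] -/
theorem exists_logUnit_point_of_ladder (hp : p ≠ 2) (ι : K →+* ℚ_[p]) {x₀ y₀ : ℚ}
    (h₀ : W.toAffine.Nonsingular x₀ y₀) (steps : List QStep) {xf yf : ℚ} {k : ℕ}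
    (hrun : ladderRunQ W.a₁ W.a₂ W.a₃ W.a₄ x₀ y₀ x₀ y₀ steps = some (xf, yf))
    (hcert : logUnitOKQ p k (qScalar 1 steps) xf = true) :
    ∃ Q : (W.baseChange K).toAffine.Point, ¬ IsOfFinAddOrder Q ∧ X11b.padicLogOrd W p ι Q = 0 := by
  obtain ⟨hf, hm⟩ := nsmul_some_eq_of_ladderRunQ h₀ steps hrun
  obtain ⟨hk, hmk, hx⟩ := logUnitOKQ_sound hcert
  exact exists_logUnit_point_of_nsmul_eq W p hp ι (.some x₀ y₀ h₀) hm hk hx hmk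

end Ladder

/-! ## §6 The ENDs of record with `hQW` discharged by certificate -/

section End

open Summit.BirchSwinnertonDyer.Rank1Residual.Supersingular (QStep ladderRunQ qScalar)

/-- **O5 (t′) `htamGd'`-free END (`…_cited_s0f`, p356092) with `hQW` DISCHARGED BY CERTIFICATE**: the binder
`hQW` (a `K`-point of infinite order with unit normalised `3`-adic logarithm; census column `dE = 0`, PARI) is
REPLACED by a rational base point `(x₀, y₀) ∈ W(ℚ)`, a ladder to `m • (x₀, y₀) = (x_f, y_f)` and the log-unit
check at `p = 3` (§5 `exists_logUnit_point_of_ladder`, both hypotheses `decide +kernel` per row); every other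
binder of `…_cited_s0f` verbatim, same displayed facts (Kriz–Li 1.16, Poitou–Tate, local Euler–Poincaré,
Yan–Zhu 4.15, Wuthrich Lemma 20, modularity, GZK). Nothing booked; O5 OPEN.
[cite: KrizLi2019, Thm. 1.16, Rem. 1.17 (FMS 7 (2019) e15)] [cite: SilvermanAEC2009, IV.6.4 and VII.2.2] -/
theorem o5_index_unit_of_ordinary_companion_cited_s0f_ratlog
    (hKL : KrizLi2019.thm116_padicLogHeegner_congruence)
    (hPT : ∀ (K : Type) [Field K] [NumberField K], poitouTate_selmerStructure_duality K)
    (hEP : ∀ (K : Type) [Field K] [NumberField K] (v : HeightOneSpectrum (𝓞 K)),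
      localEulerPoincareCharacteristic (v.adicCompletion K))
    (hYZ : YanZhu2026.thm415_padicValRat_bsd_rank_le_one)
    (hW20 : Wuthrich2014.lemma20_surjective_threeAdic_of_semistable)
    (hmod : exists_isNewformOf) (hGZK : rank_eq_analyticRank_of_analyticRank_le_one)
    (W G : WeierstrassCurve ℚ) [W.IsElliptic] [W.IsGloballyMinimal] [G.IsElliptic] [G.IsGloballyMinimal]
    (hcong : ∀ ℓ : ℕ, ℓ.Prime → ¬ (ℓ ∣ 3 * W.conductorNorm ℤ * G.conductorNorm ℤ) →
      ((W.LFunction ℓ : ℤ) : ZMod 3) = ((G.LFunction ℓ : ℤ) : ZMod 3))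
    (hρ : W.HasSurjectiveModNGaloisRep 3) (hadd : Addv W 3) (ht3 : NoLocalThreeTorsionAt W 3)
    (htℓ : ∀ (ℓ : ℕ) [Fact ℓ.Prime], ℓ ≠ 3 → (ℓ : ℤ) ∣ W.conductorNorm ℤ * G.conductorNorm ℤ →
      NoLocalThreeTorsionAt W ℓ)
    (hunitW : ∀ ℓ ∈ klSet W G, ℓ ≠ 3 → padicValInt 3 (nsCount W ℓ) = 0)
    (hunitG : ∀ ℓ ∈ klSet G W, ℓ ≠ 3 → padicValInt 3 (nsCount G ℓ) = 0)
    (htam : ¬ 3 ∣ W.tamagawaProduct) (htamG : ¬ 3 ∣ G.tamagawaProduct) (hordG : GoodOrd G 3)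
    (Gd : WeierstrassCurve ℚ) [Gd.IsElliptic] [Gd.IsGloballyMinimal]
    {N N' : ℕ} [NeZero N] [NeZero N'] (D : ModularParametrizationData W N)
    (D' : ModularParametrizationData G N')
    (K : Type) [Field K] [NumberField K] (hK : IsImaginaryQuadratic K)
    (hH : SatisfiesHeegnerHypothesis N K) (hH' : SatisfiesHeegnerHypothesis N' K)
    (hKoW : kolyvagin N W K) (hKoG : kolyvagin N' G K) (hGZG : gross_zagier N' G K)
    (hd : NumberField.discr K < -4)
    (hGd : ∃ C : VariableChange ℚ, C • G.quadraticTwist (NumberField.discr K : ℚ) = Gd)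
    (H : HeegnerDatum N (NumberField.discr K)) (H' : HeegnerDatum N' (NumberField.discr K))
    (ι : K →+* ℂ) (𝔭 : HeightOneSpectrum (𝓞 K)) (h𝔭 : ((3 : ℕ) : 𝓞 K) ∈ 𝔭.asIdeal)
    (he : 𝔭.asIdeal.ramificationIdx (𝓞 ℚ) = 1) (hf : 𝔭.asIdeal.inertiaDeg (𝓞 ℚ) = 1)
    (P : (W.baseChange K).toAffine.Point) (P' : (G.baseChange K).toAffine.Point)
    (hP : WeierstrassCurve.Affine.Point.map ι.toRatAlgHom P = heegnerPointComplex D H)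
    (hP' : WeierstrassCurve.Affine.Point.map ι.toRatAlgHom P' = heegnerPointComplex D' H')
    (hPinf : ¬ IsOfFinAddOrder P) (hP'inf : ¬ IsOfFinAddOrder P')
    (Wt : WeierstrassCurve ℚ) [Wt.IsElliptic]
    (hWt : ∃ C : VariableChange ℚ, C • W.quadraticTwist (NumberField.discr K : ℚ) = Wt)
    (htorst : ¬ 3 ∣ Wt.torsionOrder)
    (hSelW : Nat.card (W.selmerGroup (3 : ℤ)) = 3 ^ W.mordellWeilRank)
    (hSelWt : Nat.card (Wt.selmerGroup (3 : ℤ)) = 3 ^ Wt.mordellWeilRank)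
    {x₀ y₀ xf yf : ℚ} (h₀ : W.toAffine.Nonsingular x₀ y₀) (steps : List QStep) {k : ℕ}
    (hrun : ladderRunQ W.a₁ W.a₂ W.a₃ W.a₄ x₀ y₀ x₀ y₀ steps = some (xf, yf))
    (hcert : logUnitOKQ 3 k (qScalar 1 steps) xf = true)
    (hcD : padicValInt 3 D.maninConstant = 0) (hc3' : ¬ ((3 : ℤ) ∣ D'.maninConstant)) :
    padicValNat 3 (AddSubgroup.zmultiples P).index = 0 :=
  o5_index_unit_of_ordinary_companion_cited_s0f hKL hPT hEP hYZ hW20 hmod hGZK W G hcong hρ hadd ht3 htℓ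
    hunitW hunitG htam htamG hordG Gd D D' K hK hH hH' hKoW hKoG hGZG hd hGd H H' ι 𝔭 h𝔭 he hf P P' hP hP'
    hPinf hP'inf Wt hWt htorst hSelW hSelWt
    (exists_logUnit_point_of_ladder W 3 (by decide) (embAt K 3 𝔭 h𝔭 he hf) h₀ steps hrun hcert) hcD hc3'

/-- **O5 (t′) `htamGd'`-free END in ISO CURRENCY (`…_cited_s0f_iso`, p357191) with `hQW` DISCHARGED BY
CERTIFICATE**: as `…_cited_s0f_ratlog`, with the congruence binder in the cell's currency `hT : TorsionIso G W 3`
(part 20; per row the `KL3X3EInstances` pattern of part 20b). After this theorem the W-side binders `hcong` (X3E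
certificate) and `hQW` (log certificate) of a KL3 (t′) row are both kernel-decidable data; `hρ`, `ht3`/`htℓ`,
`hunitW`/`hunitG`, `htam`/`htamG`, `hordG`, the `3`-descent counts, the twist's torsion and the Manin data stay
displayed. Nothing booked; O5 OPEN. [cite: KrizLi2019, Thm. 1.16, Rem. 1.17 (FMS 7 (2019) e15)]
[cite: KrausOesterle1992, Prop. 3 (i) ⇒ (iii) (pp. 262–263)] [cite: SilvermanAEC2009, IV.6.4 and VII.2.2] -/
theorem o5_index_unit_of_ordinary_companion_cited_s0f_iso_ratlog
    (hKL : KrizLi2019.thm116_padicLogHeegner_congruence)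
    (hPT : ∀ (K : Type) [Field K] [NumberField K], poitouTate_selmerStructure_duality K)
    (hEP : ∀ (K : Type) [Field K] [NumberField K] (v : HeightOneSpectrum (𝓞 K)),
      localEulerPoincareCharacteristic (v.adicCompletion K))
    (hYZ : YanZhu2026.thm415_padicValRat_bsd_rank_le_one)
    (hW20 : Wuthrich2014.lemma20_surjective_threeAdic_of_semistable)
    (hmod : exists_isNewformOf) (hGZK : rank_eq_analyticRank_of_analyticRank_le_one)
    (W G : WeierstrassCurve ℚ) [W.IsElliptic] [W.IsGloballyMinimal] [G.IsElliptic] [G.IsGloballyMinimal]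
    (hT : TorsionIso G W 3)
    (hρ : W.HasSurjectiveModNGaloisRep 3) (hadd : Addv W 3) (ht3 : NoLocalThreeTorsionAt W 3)
    (htℓ : ∀ (ℓ : ℕ) [Fact ℓ.Prime], ℓ ≠ 3 → (ℓ : ℤ) ∣ W.conductorNorm ℤ * G.conductorNorm ℤ →
      NoLocalThreeTorsionAt W ℓ)
    (hunitW : ∀ ℓ ∈ klSet W G, ℓ ≠ 3 → padicValInt 3 (nsCount W ℓ) = 0)
    (hunitG : ∀ ℓ ∈ klSet G W, ℓ ≠ 3 → padicValInt 3 (nsCount G ℓ) = 0)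
    (htam : ¬ 3 ∣ W.tamagawaProduct) (htamG : ¬ 3 ∣ G.tamagawaProduct) (hordG : GoodOrd G 3)
    (Gd : WeierstrassCurve ℚ) [Gd.IsElliptic] [Gd.IsGloballyMinimal]
    {N N' : ℕ} [NeZero N] [NeZero N'] (D : ModularParametrizationData W N)
    (D' : ModularParametrizationData G N')
    (K : Type) [Field K] [NumberField K] (hK : IsImaginaryQuadratic K)
    (hH : SatisfiesHeegnerHypothesis N K) (hH' : SatisfiesHeegnerHypothesis N' K)
    (hKoW : kolyvagin N W K) (hKoG : kolyvagin N' G K) (hGZG : gross_zagier N' G K)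
    (hd : NumberField.discr K < -4)
    (hGd : ∃ C : VariableChange ℚ, C • G.quadraticTwist (NumberField.discr K : ℚ) = Gd)
    (H : HeegnerDatum N (NumberField.discr K)) (H' : HeegnerDatum N' (NumberField.discr K))
    (ι : K →+* ℂ) (𝔭 : HeightOneSpectrum (𝓞 K)) (h𝔭 : ((3 : ℕ) : 𝓞 K) ∈ 𝔭.asIdeal)
    (he : 𝔭.asIdeal.ramificationIdx (𝓞 ℚ) = 1) (hf : 𝔭.asIdeal.inertiaDeg (𝓞 ℚ) = 1)
    (P : (W.baseChange K).toAffine.Point) (P' : (G.baseChange K).toAffine.Point)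
    (hP : WeierstrassCurve.Affine.Point.map ι.toRatAlgHom P = heegnerPointComplex D H)
    (hP' : WeierstrassCurve.Affine.Point.map ι.toRatAlgHom P' = heegnerPointComplex D' H')
    (hPinf : ¬ IsOfFinAddOrder P) (hP'inf : ¬ IsOfFinAddOrder P')
    (Wt : WeierstrassCurve ℚ) [Wt.IsElliptic]
    (hWt : ∃ C : VariableChange ℚ, C • W.quadraticTwist (NumberField.discr K : ℚ) = Wt)
    (htorst : ¬ 3 ∣ Wt.torsionOrder)
    (hSelW : Nat.card (W.selmerGroup (3 : ℤ)) = 3 ^ W.mordellWeilRank)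
    (hSelWt : Nat.card (Wt.selmerGroup (3 : ℤ)) = 3 ^ Wt.mordellWeilRank)
    {x₀ y₀ xf yf : ℚ} (h₀ : W.toAffine.Nonsingular x₀ y₀) (steps : List QStep) {k : ℕ}
    (hrun : ladderRunQ W.a₁ W.a₂ W.a₃ W.a₄ x₀ y₀ x₀ y₀ steps = some (xf, yf))
    (hcert : logUnitOKQ 3 k (qScalar 1 steps) xf = true)
    (hcD : padicValInt 3 D.maninConstant = 0) (hc3' : ¬ ((3 : ℤ) ∣ D'.maninConstant)) :
    padicValNat 3 (AddSubgroup.zmultiples P).index = 0 :=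
  o5_index_unit_of_ordinary_companion_cited_s0f_iso hKL hPT hEP hYZ hW20 hmod hGZK W G hT hρ hadd ht3 htℓ
    hunitW hunitG htam htamG hordG Gd D D' K hK hH hH' hKoW hKoG hGZG hd hGd H H' ι 𝔭 h𝔭 he hf P P' hP hP'
    hPinf hP'inf Wt hWt htorst hSelW hSelWt
    (exists_logUnit_point_of_ladder W 3 (by decide) (embAt K 3 𝔭 h𝔭 he hf) h₀ steps hrun hcert) hcD hc3'

end End

end Summit.BirchSwinnertonDyer.Rank1Residual.O5.HeegnerLogTransport

end
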